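import Mathlib.Algebra.Group.TransferInstance
import Mathlib.LinearAlgebra.CliffordAlgebra.Conjugation
import Mathlib.LinearAlgebra.ExteriorAlgebra.Basic
import Mathlib.RingTheory.Kaehler.Basic
import HarnessLib

/-!
# The exterior derivative on Kähler forms, I: the auxiliary twisted module

For a commutative ring `A` and a commutative `A`-algebra `B`, let `Ω[B⁄A]` be the module of Kähler
differentials (Mathlib's `KaehlerDifferential`, universal derivation `D = KaehlerDifferential.D A B`)
and `E = ExteriorAlgebra B Ω[B⁄A] = ⨁ₙ ⋀ⁿ_B Ω[B⁄A]` the algebra of (algebraic) differential forms of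
`B/A`. The exterior derivative `d : E → E` (constructed in the sequel
`Crystalline/KaehlerExteriorDerivative`) is `A`-linear but not `B`-linear, so the universal property
of the exterior algebra over `B` does not apply to it directly. This file sets up the "odd dual
numbers" device that reduces its construction to universal properties Mathlib has:

* `ι_mul_eq_involute_mul_ι`: one-forms supercommute with everything, `ι m * x = x̄ * ι m`
  (`x̄ = CliffordAlgebra.involute x`, the grading involution `(-1)ᵖ` on `p`-forms);
* `KaehlerExteriorDerivative.Aux A B`: pairs `(u, v)` of forms ("`u + θ v`", `θ` odd, `θ² = 0`) with
  the TWISTED `B`-module structure `b • (u, v) = (b u, b v + D b · u)` ("`b` acts as `b + θ D b`");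
* `Aux.op x w`: the `B`-linear operator `(u, v) ↦ (x u, x̄ v + w u)` ("left multiplication by
  `x + θ w`"), with the composition law `op x w ∘ op x' w' = op (x x') (x̄ w' + w x')` (`op_comp`);
* `Aux.delta`: the `A`-derivation `t ↦ op (D t) 0` of `B` into `End_B (Aux A B)`; its lift
  `Aux.phi : Ω[B⁄A] →ₗ[B] End_B (Aux A B)` (Mathlib's `Derivation.liftKaehlerDifferential`), which
  squares to zero (`phi_mul_phi`); and the resulting algebra map
  `Aux.theta : E →ₐ[B] End_B (Aux A B)` (Mathlib's `ExteriorAlgebra.lift`).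

In the sequel, `d x` is read off as the `θ`-coefficient of `theta x (1, 0)` and the multiplicativity
of `theta` becomes the graded Leibniz rule.

Sources for the mathematics (the exterior differential on `⋀ Ω¹`): N. Bourbaki, *Algèbre* X §2
no. 10; EGA IV₄ (Publ. IHÉS 32, 1967) §16.6; The Stacks project, Tag 0FKF; the device of adjoining an
odd square-zero variable to produce odd derivations is standard superalgebra. [folklore]
Everything here is proved; no named facts. NOT here: `d` itself (sequel).
-/

noncomputable section

namespace Literature.AlgebraicGeometry.Crystalline

open KaehlerDifferential (D)
open ExteriorAlgebra (ι)

universe u v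

/-! ### A supercommutation lemma in the exterior algebra -/

section ExteriorAlgebra

variable {R : Type u} [CommRing R] {M : Type v} [AddCommGroup M] [Module R M]

/-- In the exterior algebra, a generator `ι m` supercommutes with every element:
`ι m * x = x̄ * ι m`, where `x̄ = involute x` is the grading involution (`(-1)ᵖ` on `⋀ᵖ M`).
[folklore] -/
theorem ι_mul_eq_involute_mul_ι (m : M) (x : ExteriorAlgebra R M) :
    ι R m * x = CliffordAlgebra.involute x * ι R m := by
  induction x using ExteriorAlgebra.induction with
  | algebraMap r => rw [AlgHom.commutes, Algebra.commutes]
  | ι y =>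
    rw [CliffordAlgebra.involute_ι, neg_mul, eq_neg_iff_add_eq_zero]
    exact ExteriorAlgebra.ι_add_mul_swap m y
  | mul a b ha hb => rw [← mul_assoc, ha, mul_assoc, hb, ← mul_assoc, map_mul]
  | add a b ha hb => rw [mul_add, ha, hb, map_add, add_mul]

/-- `involute (ι m * ι m') = ι m * ι m'`: a product of two one-forms is even. [folklore] -/
theorem involute_ι_mul_ι (m m' : M) :
    CliffordAlgebra.involute (ι R m * ι R m' : ExteriorAlgebra R M) = ι R m * ι R m' := by
  rw [map_mul, CliffordAlgebra.involute_ι, CliffordAlgebra.involute_ι, neg_mul_neg]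

/-- For a tower `A → B` and a `B`-module `M` with compatible `A`-action, the `A`- and `B`-actions
on the exterior algebra `⋀_B M` form a scalar tower. (Mathlib states this instance for Clifford
algebras, but at this pin instance synthesis does not find it for the default `B`-algebra structure —
the two `B`-algebra structures on a Clifford algebra are not reducibly defeq, cf. the comment at
`CliffordAlgebra.instAlgebra'`; the statement holds by `rfl` on `algebraMap`, which is how we record
it.) [folklore] -/
instance isScalarTower_exteriorAlgebra (A : Type*) [CommRing A] [Algebra A R] [Module A M]
    [IsScalarTower A R M] : IsScalarTower A R (ExteriorAlgebra R M) :=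
  IsScalarTower.of_algebraMap_eq fun _ ↦ rfl

end ExteriorAlgebra

/-! ### The twisted module `Aux A B` and the operators `op x w` -/

variable (A : Type u) (B : Type v) [CommRing A] [CommRing B] [Algebra A B]

namespace KaehlerExteriorDerivative

/-- Auxiliary carrier for the construction of the exterior derivative: pairs `(u, v)` of
differential forms, to be equipped with the twisted `B`-action `b • (u, v) = (b u, b v + D b · u)`
("`(u, v) = u + θ v` for an odd square-zero `θ` with `b ↦ b + θ D b`"). [folklore] -/
@[ext]
structure Aux where
  /-- the first ("even in `θ`") component -/
  fst : ExteriorAlgebra B (Ω[B⁄A])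
  /-- the second ("coefficient of `θ`") component -/
  snd : ExteriorAlgebra B (Ω[B⁄A])

namespace Aux

variable {A B}

/-- `Aux A B` is, as a set, `E × E` (`E` the exterior algebra of `Ω[B⁄A]`). [folklore] -/
def equivProd : Aux A B ≃ ExteriorAlgebra B (Ω[B⁄A]) × ExteriorAlgebra B (Ω[B⁄A]) where
  toFun x := (x.fst, x.snd)
  invFun p := ⟨p.1, p.2⟩
  left_inv _ := rfl
  right_inv _ := rfl

/-- The (componentwise) additive group structure on `Aux A B`, transported from `E × E`.
[folklore] -/
instance : AddCommGroup (Aux A B) := (equivProd (A := A) (B := B)).addCommGroup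

/-- Addition is componentwise. [folklore] -/
@[simp] theorem fst_add (x y : Aux A B) : (x + y).fst = x.fst + y.fst := rfl
/-- Addition is componentwise. [folklore] -/
@[simp] theorem snd_add (x y : Aux A B) : (x + y).snd = x.snd + y.snd := rfl
/-- Zero is componentwise. [folklore] -/
@[simp] theorem fst_zero : (0 : Aux A B).fst = 0 := rfl
/-- Zero is componentwise. [folklore] -/
@[simp] theorem snd_zero : (0 : Aux A B).snd = 0 := rfl
/-- Negation is componentwise. [folklore] -/
@[simp] theorem fst_neg (x : Aux A B) : (-x).fst = -x.fst := rfl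
/-- Negation is componentwise. [folklore] -/
@[simp] theorem snd_neg (x : Aux A B) : (-x).snd = -x.snd := rfl
/-- Subtraction is componentwise. [folklore] -/
@[simp] theorem fst_sub (x y : Aux A B) : (x - y).fst = x.fst - y.fst := rfl
/-- Subtraction is componentwise. [folklore] -/
@[simp] theorem snd_sub (x y : Aux A B) : (x - y).snd = x.snd - y.snd := rfl

/-- The TWISTED action of `B` on `Aux A B`: `b • (u, v) = (b u, b v + D b · u)`. [folklore] -/
instance : SMul B (Aux A B) :=
  ⟨fun b x ↦ ⟨b • x.fst, b • x.snd + ι B (D A B b) * x.fst⟩⟩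

/-- First component of the twisted action: `(b • x).1 = b x.1`. [folklore] -/
@[simp] theorem fst_smul (b : B) (x : Aux A B) : (b • x).fst = b • x.fst := rfl
/-- Second component of the twisted action: `(b • x).2 = b x.2 + D b · x.1`. [folklore] -/
@[simp] theorem snd_smul (b : B) (x : Aux A B) :
    (b • x).snd = b • x.snd + ι B (D A B b) * x.fst := rfl

/-- The twisted action is a `B`-module structure (this uses `D (s t) = s D t + t D s` and that
`B` is central in the exterior algebra). [folklore] -/
instance : Module B (Aux A B) where
  one_smul x := by ext <;> simp
  mul_smul s t x := by
    ext
    · simp [mul_smul]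
    · simp only [snd_smul, fst_smul, Derivation.leibniz, map_add, LinearMap.map_smul, add_mul,
        smul_add, mul_smul, smul_mul_assoc, mul_smul_comm]
      abel
  smul_zero b := by ext <;> simp
  smul_add b x y := by
    ext
    · simp
    · simp only [snd_smul, snd_add, fst_add, smul_add, mul_add]
      abel
  add_smul s t x := by
    ext
    · simp [add_smul]
    · simp only [snd_smul, snd_add, add_smul, map_add, add_mul]
      abel
  zero_smul x := by ext <;> simp

/-- `A` acts on `Aux A B` through `A → B` (so that `a • (u, v) = (a u, a v)`, as `D a = 0`).
[folklore] -/
instance : Module A (Aux A B) := Module.compHom (Aux A B) (algebraMap A B)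

/-- The `A`-action is the `B`-action through `algebraMap A B` (by definition). [folklore] -/
theorem algebraMap_smul_eq (a : A) (x : Aux A B) : a • x = algebraMap A B a • x := rfl

/-- The `A`-action is componentwise: first component. [folklore] -/
@[simp] theorem fst_smul_of_tower (a : A) (x : Aux A B) : (a • x).fst = a • x.fst := by
  rw [algebraMap_smul_eq, fst_smul, algebraMap_smul]

/-- The `A`-action is componentwise: second component (`D a = 0`). [folklore] -/
@[simp] theorem snd_smul_of_tower (a : A) (x : Aux A B) : (a • x).snd = a • x.snd := by
  rw [algebraMap_smul_eq, snd_smul, algebraMap_smul, Derivation.map_algebraMap, map_zero, zero_mul,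
    add_zero]

/-- [folklore] -/
instance : IsScalarTower A B (Aux A B) :=
  ⟨fun a b x ↦ by rw [algebraMap_smul_eq, ← mul_smul, Algebra.smul_def]⟩

/-- [folklore] -/
instance : SMulCommClass B A (Aux A B) :=
  ⟨fun b a x ↦ by rw [algebraMap_smul_eq, algebraMap_smul_eq, ← mul_smul, ← mul_smul, mul_comm]⟩

/-- [folklore] -/
instance : SMulCommClass A B (Aux A B) :=
  ⟨fun a b x ↦ (smul_comm b a x).symm⟩

/-- The operator `op x w : (u, v) ↦ (x u, x̄ v + w u)` on `Aux A B` ("left multiplication by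
`x + θ w`"); it is linear for the twisted `B`-action because one-forms supercommute with everything
(`ι_mul_eq_involute_mul_ι`). [folklore] -/
def op (x w : ExteriorAlgebra B (Ω[B⁄A])) : Aux A B →ₗ[B] Aux A B where
  toFun n := ⟨x * n.fst, CliffordAlgebra.involute x * n.snd + w * n.fst⟩
  map_add' n n' := by
    ext
    · simp [mul_add]
    · simp only [fst_add, snd_add, mul_add]
      abel
  map_smul' b n := by
    ext
    · simp
    · simp only [fst_smul, snd_smul, RingHom.id_apply, mul_add, mul_smul_comm, smul_add]
      rw [← mul_assoc, ← mul_assoc, ι_mul_eq_involute_mul_ι (D A B b) x]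
      abel

/-- `(op x w (u, v)).1 = x u`. [folklore] -/
@[simp] theorem op_apply_fst (x w : ExteriorAlgebra B (Ω[B⁄A])) (n : Aux A B) :
    (op x w n).fst = x * n.fst := rfl

/-- `(op x w (u, v)).2 = x̄ v + w u`. [folklore] -/
@[simp] theorem op_apply_snd (x w : ExteriorAlgebra B (Ω[B⁄A])) (n : Aux A B) :
    (op x w n).snd = CliffordAlgebra.involute x * n.snd + w * n.fst := rfl

/-- The composition law of the operators `op`: `(x + θw)(x' + θw') = xx' + θ(x̄ w' + w x')`.
[folklore] -/
theorem op_comp (x w x' w' : ExteriorAlgebra B (Ω[B⁄A])) :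
    op (A := A) x w ∘ₗ op x' w' = op (x * x') (CliffordAlgebra.involute x * w' + w * x') := by
  refine LinearMap.ext fun n ↦ ?_
  ext
  · simp [mul_assoc]
  · simp only [LinearMap.coe_comp, Function.comp_apply, op_apply_snd, op_apply_fst, map_mul, mul_add,
      add_mul, mul_assoc]
    abel

/-- `op` is additive in the pair `(x, w)`. [folklore] -/
theorem op_add (x w x' w' : ExteriorAlgebra B (Ω[B⁄A])) :
    op (A := A) (x + x') (w + w') = op x w + op x' w' := by
  refine LinearMap.ext fun n ↦ ?_
  ext
  · simp [add_mul]
  · simp only [op_apply_snd, LinearMap.add_apply, snd_add, map_add, add_mul]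
    abel

/-- `op 0 0 = 0`. [folklore] -/
@[simp] theorem op_zero : op (A := A) (B := B) 0 0 = 0 :=
  LinearMap.ext fun n ↦ by ext <;> simp

/-- The twisted scalar action of `b` is `op b (D b)`. [folklore] -/
theorem smul_eq_op_apply (b : B) (n : Aux A B) :
    b • n = op (algebraMap B _ b) (ι B (D A B b)) n := by
  ext
  · simp [Algebra.smul_def]
  · simp [Algebra.smul_def]

/-- On `B`-linear endomorphisms of `Aux A B`, the scalar action of `b` is post-composition with
`op b (D b)`. [folklore] -/
theorem smul_end_eq_op_comp (b : B) (g : Module.End B (Aux A B)) :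
    b • g = op (algebraMap B _ b) (ι B (D A B b)) ∘ₗ g :=
  LinearMap.ext fun n ↦ by rw [LinearMap.smul_apply, LinearMap.comp_apply, smul_eq_op_apply]

/-- The basic point `(1, 0)` of `Aux A B`. [folklore] -/
def base : Aux A B := ⟨1, 0⟩

/-- `base = (1, 0)`: first component. [folklore] -/
@[simp] theorem fst_base : (base : Aux A B).fst = 1 := rfl
/-- `base = (1, 0)`: second component. [folklore] -/
@[simp] theorem snd_base : (base : Aux A B).snd = 0 := rfl

/-! ### The derivation `t ↦ op (D t) 0` and its lifts -/

variable (A B)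

/-- The `A`-derivation `B → End_B (Aux A B)`, `t ↦ op (D t) 0 = ((u, v) ↦ (D t · u, -D t · v))`
("multiplication by the odd element `D t`"). [folklore] -/
def delta : Derivation A B (Module.End B (Aux A B)) where
  toFun t := op (ι B (D A B t)) 0
  map_add' s t := by rw [map_add, map_add, ← op_add, add_zero]
  map_smul' a t := by
    refine LinearMap.ext fun n ↦ ?_
    rw [Derivation.map_smul, LinearMap.map_smul_of_tower, RingHom.id_apply, LinearMap.smul_apply]
    ext
    · rw [op_apply_fst, fst_smul_of_tower, op_apply_fst, smul_mul_assoc]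
    · rw [op_apply_snd, snd_smul_of_tower, op_apply_snd, AlgHom.map_smul_of_tower, smul_mul_assoc,
        zero_mul, add_zero, add_zero]
  map_one_eq_zero' := by
    change op (ι B (D A B 1)) 0 = 0
    rw [Derivation.map_one_eq_zero, map_zero, op_zero]
  leibniz' s t := by
    change op (ι B (D A B (s * t))) 0 = s • op (ι B (D A B t)) 0 + t • op (ι B (D A B s)) 0
    refine LinearMap.ext fun n ↦ ?_
    have h : ι B (D A B s) * (ι B (D A B t) * n.fst) + ι B (D A B t) * (ι B (D A B s) * n.fst) = 0 := by
      rw [← mul_assoc, ← mul_assoc, ← add_mul, ExteriorAlgebra.ι_add_mul_swap, zero_mul]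
    ext
    · simp only [op_apply_fst, Derivation.leibniz, map_add, LinearMap.map_smul, add_mul,
        smul_mul_assoc, LinearMap.add_apply, LinearMap.smul_apply, fst_add, fst_smul]
    · simp only [op_apply_snd, Derivation.leibniz, map_add, zero_mul, add_zero,
        LinearMap.add_apply, LinearMap.smul_apply, snd_add, snd_smul, op_apply_fst,
        CliffordAlgebra.involute_ι, map_smul, neg_mul, smul_neg, add_mul, smul_mul_assoc]
      rw [← sub_eq_zero, ← neg_eq_zero, ← h]
      abel

/-- `delta t = op (D t) 0` (by definition). [folklore] -/
@[simp] theorem delta_apply (t : B) : delta A B t = op (ι B (D A B t)) 0 := rfl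

/-- The `B`-linear lift `f : Ω[B⁄A] → End_B (Aux A B)` of `delta` (universal property of Kähler
differentials). [folklore] -/
def phi : Ω[B⁄A] →ₗ[B] Module.End B (Aux A B) := (delta A B).liftKaehlerDifferential

/-- `f (D t) = op (D t) 0`: the lift extends `delta`. [folklore] -/
@[simp] theorem phi_D (t : B) : phi A B (D A B t) = op (ι B (D A B t)) 0 :=
  (delta A B).liftKaehlerDifferential_comp_D t

/-- Every `f ω` is an operator `op (ι ω) w` with `w` even (proved by induction over
`Ω[B⁄A] = span_B (range D)`). [folklore] -/
theorem exists_phi_eq_op (ω : Ω[B⁄A]) :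
    ∃ w : ExteriorAlgebra B (Ω[B⁄A]), CliffordAlgebra.involute w = w ∧ phi A B ω = op (ι B ω) w := by
  have hω : ω ∈ Submodule.span B (Set.range (D A B)) := by
    rw [KaehlerDifferential.span_range_derivation]; trivial
  induction hω using Submodule.span_induction with
  | mem x hx =>
    obtain ⟨t, rfl⟩ := hx
    exact ⟨0, map_zero _, phi_D A B t⟩
  | zero => exact ⟨0, map_zero _, by rw [map_zero, map_zero, op_zero]⟩
  | add x y _ _ hx hy =>
    obtain ⟨w, hw, hfw⟩ := hx
    obtain ⟨w', hw', hfw'⟩ := hy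
    exact ⟨w + w', by rw [map_add, hw, hw'], by rw [map_add, hfw, hfw', map_add, op_add]⟩
  | smul b x _ hx =>
    obtain ⟨w, hw, hfw⟩ := hx
    refine ⟨b • w + ι B (D A B b) * ι B x, ?_, ?_⟩
    · rw [map_add, map_smul, hw, involute_ι_mul_ι]
    · rw [LinearMap.map_smul, hfw, smul_end_eq_op_comp, op_comp, AlgHom.commutes, LinearMap.map_smul,
        Algebra.smul_def, Algebra.smul_def]

/-- `f ω ∘ f ω = 0`: the square-zero condition of the universal property of the exterior algebra.
[folklore] -/
theorem phi_mul_phi (ω : Ω[B⁄A]) : phi A B ω * phi A B ω = 0 := by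
  obtain ⟨w, hw, h⟩ := exists_phi_eq_op A B ω
  have hc : ι B ω * w = w * ι B ω := by rw [ι_mul_eq_involute_mul_ι, hw]
  rw [h, Module.End.mul_eq_comp, op_comp, ExteriorAlgebra.ι_sq_zero, CliffordAlgebra.involute_ι,
    neg_mul, hc, neg_add_cancel, op_zero]

/-- The algebra map `Θ : E →ₐ[B] End_B (Aux A B)` extending `f` (universal property of the exterior
algebra); `Θ x` will be `op x (d x)`. [folklore] -/
def theta : ExteriorAlgebra B (Ω[B⁄A]) →ₐ[B] Module.End B (Aux A B) :=
  ExteriorAlgebra.lift B ⟨phi A B, phi_mul_phi A B⟩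

/-- `Θ (ι ω) = f ω`: `Θ` extends `f`. [folklore] -/
@[simp] theorem theta_ι (ω : Ω[B⁄A]) : theta A B (ι B ω) = phi A B ω :=
  ExteriorAlgebra.lift_ι_apply B _ _ ω

end Aux

end KaehlerExteriorDerivative

end Literature.AlgebraicGeometry.Crystalline

end
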